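import Summits.QuantumFields.GaugeBoot.FrameTwoDimLinkRPPrep
import Summits.QuantumFields.GaugeBoot.TiltedBoxEvenMidAxisRPTwoDim
import HarnessLib

/-!
# Link reflection positivity of two-dimensional site frames at EVERY real `β` (gauge-boot, L3 positive supplement; link reflection in two dimensions at every `β`, part 3)

HONEST FRAMING (cell `pub-gaugeboot`, page 1 of every file): the venture produces certified bounds
on lattice expectations at stated coupling, gauge group, dimension and torus size; NOT a mass gap,
NOT a continuum limit, NOT a string tension; NOT Yang–Mills-summit-bearing (barriers
`FixedCouplingUltralocality`, `PerturbativeInvisibility`). A structural POSITIVE result about a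
reflection of a two-dimensional periodic lattice; it bounds no expectation of the venture's tables.

`TiltedLinkRPPositivity.lean` proved the Osterwalder–Seiler link (mid-plane) reflection positivity
of the Wilson measure of ANY periodic lattice with a site frame for `β ≥ 0`, and
`FrameLinkRPNegativeBeta.lean` / `CubicTorusLinkRPNegativeBeta.lean` proved that the sign condition is
SHARP in `d ≥ 3` for `SU(3)`-type representations (link RP fails at every `β < 0`: the baryonic theta
graph between adjacent transverse sites has an odd number of links). This module settles the
remaining TWO-DIMENSIONAL case positively, for every compact group:

* **`IsTwoDimFrame.linkRP_integral_conj_mul_nonneg`** — for a two-dimensional site frame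
  (`FrameTwoDimAnnulus.lean`: a site frame along `k`, one transverse direction `l` of even period
  `2m`, the site group generated by `e_k, e_l`), a compact second countable `G`, a continuous `ρ` and
  EVERY real `β`: `0 ≤ ∫ conj F(ΘU) F(U) dμ_β` for every bounded measurable observable `F` of the
  closed half `{1 ≤ h ≤ Q}` (the blocks and the torus instances: `CubicTorusLinkRPTwoDim.lean`).

**Proof** (Migdal's gluing, as for the tilted two-dimensional boxes of
`TiltedBoxEvenMidAxisRPTwoDim.lean`, now on an arbitrary two-dimensional site frame). The Boltzmann
weight splits as `e^{-βN#P} · H · ∏_{upper annulus} · ∏_{lower annulus}`, `H = g·conj(g∘Θ)`,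
`g = F e^{βA}` (`IsTwoDimFrame.boltzmann_split`); Migdal's recursion integrates the `2m` rungs of each
annulus (`SlabKernel.integral_mul_annulus`, twice), leaving `k_ψ(w₁, w₁∘Θ) · k_ψ(w_Q, w_Q∘Θ)`,
`ψ = ω_β^{⋆m}`, of the words of the layers `1` and `Q` (both slabs EXACT: `Θ` exchanges the letter
words, `k_ψ` is symmetric); the Gram form `k_ψ(a, b) = ∫ e_ψ(a,u) e_ψ(b,u) du` (`SlabKernelGram.lean`,
from the EVEN number of plaquettes around each annulus) turns the integral into
`∫∫ (∫ Ψ_{u,u'} conj(Ψ_{u,u'}∘Θ) dμ₀) du du'`, `Ψ_{u,u'} = g · e_ψ(w₁,u) · e_ψ(w_Q,u')` an observable of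
the positive links, and `LatticeRP.integral_splice_mul_conj_comp_of_shared_nonneg` (no shared block, no
crossing links) makes each inner integral non-negative. No character expansion, no sign condition on
`β`: the cycle transfer operator of two-dimensional Yang–Mills is a class-averaged convolution SQUARE,
positive whatever the signs of the Fourier coefficients of `ω_β` — in contrast with `d ≥ 3`
(`FrameLinkRPNegativeBeta.lean`). Small new positive result; mechanism folklore (Migdal 1975,
Osterwalder–Seiler 1978 §2).

References: A. A. Migdal, Sov. Phys. JETP 42 (1975) 413; K. Osterwalder, E. Seiler, Ann. Phys. 110
(1978) 440, §2; J. Fröhlich, R. Israel, E. H. Lieb, B. Simon, J. Stat. Phys. 22 (1980) 297, §3;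
M. Biskup, in LNM 1970 (2009) §5.4–5.5.
-/

noncomputable section

open MeasureTheory Complex Function
open scoped ComplexOrder ComplexConjugate
open Literature.MathematicalPhysics.QuantumFieldTheory (haarProbability)
open Literature.MathematicalPhysics.QuantumFieldTheory.LatticeRP (piMeasure splice splice_eq_piecewise
  integral_splice_mul_conj_comp_of_shared_nonneg)
open Literature.RepresentationTheory.CompactGroups

namespace Summit.QuantumFields.GaugeBoot

namespace TiltedRP

variable {A : Type*} [AddCommGroup A] [Fintype A] [DecidableEq A] {d : ℕ}

/-! ## The reflection is continuous -/

omit [Fintype A] [DecidableEq A] in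
/-- `Θ` is continuous (a relabelling of the links composed with inversions). [folklore] -/
theorem continuous_configMidReflect {G : Type*} [Group G] [TopologicalSpace G] [IsTopologicalGroup G]
    (e : Fin d → A) (k : Fin d) (σ : A →+ A) : Continuous (configMidReflect (G := G) e k σ) := by
  refine continuous_pi fun l => ?_
  unfold configMidReflect
  split_ifs
  · exact (continuous_apply _).inv
  · exact continuous_apply _

namespace IsTwoDimFrame

open TwoDimFrame

variable {e : Fin d → A} {k l : Fin d} {σ : A →+ A} {Q : ℕ} {h : A →+ ZMod (2 * Q)} {m : ℕ}
variable (hT : IsTwoDimFrame e k l σ Q h m)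
variable {N : ℕ} {G : Type*} [Group G] [TopologicalSpace G] [IsTopologicalGroup G] [CompactSpace G]
  [MeasurableSpace G] [BorelSpace G] [SecondCountableTopology G]
variable (ρ : G →* Matrix (Fin N) (Fin N) ℂ)
include hT

/-- **Both annuli integrated**:
`∫ H · ∏_{upper} plaqWt · ∏_{lower} plaqWt dμ₀ = ∫ H · k_ψ(w₁, w₁∘Θ) · k_ψ(w_Q, w_Q∘Θ) dμ₀`,
`w₁ = ∏_t U((1,t); l)`, `w_Q = ∏_t U((Q,t); l)`, `ψ = ω_β^{⋆m}`. [folklore] -/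
theorem integral_midH_annuli (hρ : Continuous ρ) (β : ℝ) {F : Config A d G → ℂ} (hFm : Measurable F)
    {CF : ℝ} (hFb : ∀ U, ‖F U‖ ≤ CF) (hFo : IsMidObservable e Q h F) :
    ∫ U, IsSiteFrame.midH ρ e k σ Q h β F U *
        (∏ t ∈ Finset.range (2 * m),
          SlabKernel.plaqWt (SlabKernel.wilsonWt ρ β) (rung₂ e k l Q) (lo₂ e k l Q) (up₂ e k l Q) t U) *
        ∏ t ∈ Finset.range (2 * m),
          SlabKernel.plaqWt (SlabKernel.wilsonWt ρ β) (rung₂ e k l 0) (lo₂ e k l 0) (up₂ e k l 0) t U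
      ∂(productHaar A d G) =
    ∫ U, IsSiteFrame.midH ρ e k σ Q h β F U *
        (SlabKernel.slabKernel (SlabKernel.convPow (SlabKernel.wilsonWt ρ β) m)
          (SlabKernel.oprod (up₂ e k l 0) (2 * m) U)
          (SlabKernel.oprod (up₂ e k l 0) (2 * m) (configMidReflect e k σ U)) : ℂ) *
        (SlabKernel.slabKernel (SlabKernel.convPow (SlabKernel.wilsonWt ρ β) m)
          (SlabKernel.oprod (lo₂ e k l Q) (2 * m) U)
          (SlabKernel.oprod (lo₂ e k l Q) (2 * m) (configMidReflect e k σ U)) : ℂ)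
      ∂(productHaar A d G) := by
  haveI : IsProbabilityMeasure (haarProbability G) := CompactGroup.isProbabilityMeasure_haarMeasure_top
  have hωc := SlabKernel.continuous_wilsonWt ρ hρ β
  have hωz := SlabKernel.wilsonWt_central ρ β
  have hωi := SlabKernel.wilsonWt_inv ρ hρ β
  set ψ := SlabKernel.convPow (SlabKernel.wilsonWt ρ β) m with hψ
  have hψc : Continuous ψ := SlabKernel.continuous_convPow hωc _
  have hψz : ∀ g g', ψ (g' * g * g'⁻¹) = ψ g := SlabKernel.convPow_central hωz m
  have hψi : ∀ g, ψ g⁻¹ = ψ g := SlabKernel.convPow_inv hωz hωi m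
  obtain ⟨C, -, hC⟩ := Literature.MathematicalPhysics.QuantumLattice.exists_forall_abs_le_of_continuous hωc
  have hhm := IsSiteFrame.measurable_midH (e := e) (k := k) (σ := σ) (Q := Q) (h := h) ρ hρ β hFm
  set Ch := (|CF| * Real.exp (|β| * (N * Fintype.card (Plaq A d)))) *
    (|CF| * Real.exp (|β| * (N * Fintype.card (Plaq A d)))) with hCh
  have hhb : ∀ U, ‖IsSiteFrame.midH ρ e k σ Q h β F U‖ ≤ Ch :=
    fun U => IsSiteFrame.norm_midH_le ρ hρ β hFb U
  have hm1 : (1 : ℕ) ≤ m := hT.one_le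
  -- Step A: the lower annulus, against `h₁ = H · ∏_{upper}`
  set pU : Config A d G → ℂ := fun U => ∏ t ∈ Finset.range (2 * m),
    SlabKernel.plaqWt (SlabKernel.wilsonWt ρ β) (rung₂ e k l Q) (lo₂ e k l Q) (up₂ e k l Q) t U with hpU
  have hpUm : Measurable pU := Finset.measurable_prod _ fun t _ =>
    (SlabKernel.continuous_plaqWt hωc (fun t => continuous_apply _) (fun t => continuous_apply _) t).measurable
  have hpUb : ∀ U, ‖pU U‖ ≤ C ^ (2 * m) := fun U => by
    rw [hpU, norm_prod]
    calc ∏ t ∈ Finset.range (2 * m), ‖SlabKernel.plaqWt (SlabKernel.wilsonWt ρ β) (rung₂ e k l Q)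
          (lo₂ e k l Q) (up₂ e k l Q) t U‖ ≤ ∏ _t ∈ Finset.range (2 * m), C :=
          Finset.prod_le_prod (fun _ _ => norm_nonneg _) fun t _ => SlabKernel.norm_plaqWt_le hC t U
      _ = C ^ (2 * m) := by rw [Finset.prod_const, Finset.card_range]
  have hpUu : ∀ s U z, pU (update U (rung₂ e k l 0 s) z) = pU U := fun s U z => by
    simp only [hpU]
    refine Finset.prod_congr rfl fun t _ => ?_
    exact SlabKernel.plaqWt_update_of_ne (hT.rung_self_ne_rung_zero _ _) (hT.rung_self_ne_rung_zero _ _)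
      (fun U z => hT.lo_update _ _ _ _ U z) (fun U z => hT.up_update _ _ _ _ U z) U z
  set h₁ : Config A d G → ℂ := fun U => IsSiteFrame.midH ρ e k σ Q h β F U * pU U with hh₁
  have hA : ∀ U, IsSiteFrame.midH ρ e k σ Q h β F U *
      (∏ t ∈ Finset.range (2 * m),
        SlabKernel.plaqWt (SlabKernel.wilsonWt ρ β) (rung₂ e k l Q) (lo₂ e k l Q) (up₂ e k l Q) t U) *
      ∏ t ∈ Finset.range (2 * m),
        SlabKernel.plaqWt (SlabKernel.wilsonWt ρ β) (rung₂ e k l 0) (lo₂ e k l 0) (up₂ e k l 0) t U =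
      h₁ U * ∏ t ∈ Finset.range (2 * m),
        SlabKernel.plaqWt (SlabKernel.wilsonWt ρ β) (rung₂ e k l 0) (lo₂ e k l 0) (up₂ e k l 0) t U :=
    fun U => rfl
  simp_rw [hA]
  unfold productHaar
  rw [SlabKernel.integral_mul_annulus (r := rung₂ e k l 0) (a := lo₂ e k l 0) (b := up₂ e k l 0)
    hωc hωz hm1 (hT.rung_period 0) (hT.rung_inj 0)
    (fun t => continuous_apply _) (fun t => continuous_apply _) (fun t s U z => hT.lo_update 0 t 0 s U z)
    (fun t s U z => hT.up_update 0 t 0 s U z) (h := h₁) (hhm.mul hpUm)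
    (K := Ch * C ^ (2 * m)) (fun U => by
      rw [hh₁, norm_mul]; exact mul_le_mul (hhb U) (hpUb U) (norm_nonneg _) ((norm_nonneg _).trans (hhb U)))
    (fun s U z => by simp only [hh₁, hT.midH_update_rung ρ β hFo (Or.inl rfl) s U z, hpUu])]
  -- Step B: the upper annulus, against `h₂ = H · k₀`
  set k₀ : Config A d G → ℂ := fun U =>
    (SlabKernel.slabKernel ψ (SlabKernel.oprod (lo₂ e k l 0) (2 * m) U)
      (SlabKernel.oprod (up₂ e k l 0) (2 * m) U) : ℂ) with hk₀
  have hkc : Continuous fun q : G × G => SlabKernel.slabKernel ψ q.1 q.2 :=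
    SlabKernel.continuous_uncurry_slabKernel hψc
  obtain ⟨Ck, hCk⟩ := (isCompact_univ (X := G × G)).exists_bound_of_continuousOn hkc.continuousOn
  have hlo0 : Continuous (SlabKernel.oprod (lo₂ (G := G) e k l 0) (2 * m)) :=
    SlabKernel.continuous_oprod (fun t => continuous_apply _) _
  have hup0 : Continuous (SlabKernel.oprod (up₂ (G := G) e k l 0) (2 * m)) :=
    SlabKernel.continuous_oprod (fun t => continuous_apply _) _
  have hk₀m : Measurable k₀ := (Complex.continuous_ofReal.comp (hkc.comp (hlo0.prodMk hup0))).measurable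
  have hk₀b : ∀ U, ‖k₀ U‖ ≤ Ck := fun U => by rw [hk₀, Complex.norm_real]; exact hCk (_, _) (Set.mem_univ _)
  have hk₀u : ∀ s U z, k₀ (update U (rung₂ e k l Q s) z) = k₀ U := fun s U z => by
    simp only [hk₀, SlabKernel.oprod_update (fun t U z => hT.lo_update _ t _ s U z),
      SlabKernel.oprod_update (fun t U z => hT.up_update _ t _ s U z)]
  set h₂ : Config A d G → ℂ := fun U => IsSiteFrame.midH ρ e k σ Q h β F U * k₀ U with hh₂
  have hB : ∀ U, h₁ U * (SlabKernel.slabKernel (SlabKernel.convPow (SlabKernel.wilsonWt ρ β) m)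
      (SlabKernel.oprod (lo₂ e k l 0) (2 * m) U) (SlabKernel.oprod (up₂ e k l 0) (2 * m) U) : ℂ) =
      h₂ U * ∏ t ∈ Finset.range (2 * m),
        SlabKernel.plaqWt (SlabKernel.wilsonWt ρ β) (rung₂ e k l Q) (lo₂ e k l Q) (up₂ e k l Q) t U :=
    fun U => by simp only [hh₁, hh₂, hpU, hk₀]; ring
  simp_rw [hB]
  rw [SlabKernel.integral_mul_annulus (r := rung₂ e k l Q) (a := lo₂ e k l Q) (b := up₂ e k l Q)
    hωc hωz hm1 (hT.rung_period Q) (hT.rung_inj Q)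
    (fun t => continuous_apply _) (fun t => continuous_apply _) (fun t s U z => hT.lo_update Q t Q s U z)
    (fun t s U z => hT.up_update Q t Q s U z) (h := h₂) (hhm.mul hk₀m) (K := Ch * Ck)
    (fun U => by rw [hh₂, norm_mul]; exact mul_le_mul (hhb U) (hk₀b U) (norm_nonneg _) ((norm_nonneg _).trans (hhb U)))
    (fun s U z => by simp only [hh₂, hT.midH_update_rung ρ β hFo (Or.inr rfl) s U z, hk₀u])]
  -- Step C: both slabs are exact
  refine integral_congr_ae (ae_of_all _ fun U => ?_)
  simp only [hh₂, hk₀]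
  rw [← hT.oprod_up_zero_configMidReflect (2 * m) U, SlabKernel.slabKernel_symm hψc hψz hψi,
    ← hT.oprod_lo_self_configMidReflect (2 * m) U, mul_assoc]

/-- **Pointwise in the feature parameters, the mechanism applies** (no shared block, no crossing
links): `0 ≤ ∫ Ψ_{u,u'}(U) conj Ψ_{u,u'}(ΘU) dU` with `Ψ_{u,u'} = g · e_ψ(w₁, u) · e_ψ(w_Q, u')`.
[folklore] -/
theorem integral_psi_nonneg (hρ : Continuous ρ) (β : ℝ) {F : Config A d G → ℂ} (hFm : Measurable F)
    {CF : ℝ} (hFb : ∀ U, ‖F U‖ ≤ CF) (hFo : IsMidObservable e Q h F) (u u' : G) :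
    0 ≤ ∫ U, (IsSiteFrame.midGObs ρ e k Q h β F U *
        (SlabKernel.featureMap (SlabKernel.convPow (SlabKernel.wilsonWt ρ β) m)
          (SlabKernel.oprod (up₂ e k l 0) (2 * m) U) u : ℂ) *
        (SlabKernel.featureMap (SlabKernel.convPow (SlabKernel.wilsonWt ρ β) m)
          (SlabKernel.oprod (lo₂ e k l Q) (2 * m) U) u' : ℂ)) *
      conj (IsSiteFrame.midGObs ρ e k Q h β F (configMidReflect e k σ U) *
        (SlabKernel.featureMap (SlabKernel.convPow (SlabKernel.wilsonWt ρ β) m)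
          (SlabKernel.oprod (up₂ e k l 0) (2 * m) (configMidReflect e k σ U)) u : ℂ) *
        (SlabKernel.featureMap (SlabKernel.convPow (SlabKernel.wilsonWt ρ β) m)
          (SlabKernel.oprod (lo₂ e k l Q) (2 * m) (configMidReflect e k σ U)) u' : ℂ))
      ∂(productHaar A d G) := by
  haveI : IsProbabilityMeasure (haarProbability G) := CompactGroup.isProbabilityMeasure_haarMeasure_top
  set ψ := SlabKernel.convPow (SlabKernel.wilsonWt ρ β) m with hψ
  have hψc : Continuous ψ := SlabKernel.continuous_convPow (SlabKernel.continuous_wilsonWt ρ hρ β) _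
  obtain ⟨Cψ, -, hCψ⟩ := Literature.MathematicalPhysics.QuantumLattice.exists_forall_abs_le_of_continuous hψc
  have hw1 : Continuous (SlabKernel.oprod (up₂ (G := G) e k l 0) (2 * m)) :=
    SlabKernel.continuous_oprod (fun t => continuous_apply _) _
  have hwQ : Continuous (SlabKernel.oprod (lo₂ (G := G) e k l Q) (2 * m)) :=
    SlabKernel.continuous_oprod (fun t => continuous_apply _) _
  set Ψ : Config A d G → ℂ := fun U => IsSiteFrame.midGObs ρ e k Q h β F U *
    (SlabKernel.featureMap ψ (SlabKernel.oprod (up₂ e k l 0) (2 * m) U) u : ℂ) *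
    (SlabKernel.featureMap ψ (SlabKernel.oprod (lo₂ e k l Q) (2 * m) U) u' : ℂ) with hΨ
  have hgm := IsSiteFrame.measurable_midGObs (e := e) (k := k) (Q := Q) (h := h) ρ hρ β hFm
  have hgb : ∀ U, ‖IsSiteFrame.midGObs ρ e k Q h β F U‖ ≤
      |CF| * Real.exp (|β| * (N * Fintype.card (Plaq A d))) :=
    fun U => IsSiteFrame.norm_midGObs_le_abs ρ hρ β hFb U
  have hΨm : Measurable Ψ :=
    (hgm.mul (Complex.measurable_ofReal.comp ((SlabKernel.continuous_featureMap_left hψc u).comp hw1).measurable)).mul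
      (Complex.measurable_ofReal.comp ((SlabKernel.continuous_featureMap_left hψc u').comp hwQ).measurable)
  have hCψ0 : 0 ≤ Cψ := (abs_nonneg _).trans (hCψ 1)
  have hΨb : ∀ U, ‖Ψ U‖ ≤ |CF| * Real.exp (|β| * (N * Fintype.card (Plaq A d))) * Cψ * Cψ := fun U => by
    rw [hΨ, norm_mul, norm_mul, Complex.norm_real, Complex.norm_real, Real.norm_eq_abs, Real.norm_eq_abs]
    exact mul_le_mul (mul_le_mul (hgb U) (SlabKernel.abs_featureMap_le hCψ _ _) (abs_nonneg _)
      ((norm_nonneg _).trans (hgb U))) (SlabKernel.abs_featureMap_le hCψ _ _) (abs_nonneg _)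
      (mul_nonneg ((norm_nonneg _).trans (hgb U)) hCψ0)
  have hΨdep : DependsOn Ψ ((midPosBlock e Q h ∪ ∅ ∪ ∅ : Finset (Link A d)) : Set (Link A d)) := by
    intro U V hUV
    simp only [Finset.union_empty] at hUV
    have hpos : ∀ l', IsMidPosLink e Q h l' → U l' = V l' :=
      fun l' hl' => hUV l' (by rw [Finset.mem_coe]; exact mem_midPosBlock.2 hl')
    have h1 : SlabKernel.oprod (up₂ e k l 0) (2 * m) U = SlabKernel.oprod (up₂ e k l 0) (2 * m) V := by
      unfold SlabKernel.oprod
      congr 1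
      refine List.map_congr_left fun t _ => hpos _ ?_
      simp only [zero_add]
      exact hT.isMidPosLink_site_one t
    have h2 : SlabKernel.oprod (lo₂ e k l Q) (2 * m) U = SlabKernel.oprod (lo₂ e k l Q) (2 * m) V := by
      unfold SlabKernel.oprod
      congr 1
      exact List.map_congr_left fun t _ => hpos _ (hT.isMidPosLink_site_self t)
    simp only [hΨ, hT.toIsSiteFrame.midGObs_congr_pos ρ β hFo hpos, h1, h2]
  have key := integral_splice_mul_conj_comp_of_shared_nonneg (haarProbability G) ∅ (midPosBlock e Q h) ∅ _
    (hT.toIsSiteFrame.measurePreserving_configMidReflect (G := G)) (fun U l' hl' => by simp at hl')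
    (fun l' hl' => hT.toIsSiteFrame.dependsOn_configMidReflect_apply l'
      (Finset.mem_union_left _ (by simpa using hl')))
    (Finset.disjoint_empty_left _) (Finset.disjoint_empty_left _) hΨm hΨb hΨdep
  simp only [splice_eq_piecewise, Finset.piecewise_empty] at key
  unfold productHaar
  rwa [integral_fun_fst (fun U => Ψ U * conj (Ψ (configMidReflect e k σ U))), probReal_univ, one_smul] at key

/-- **After the annuli: the double Gram form is non-negative**,
`0 ≤ ∫ H · k_ψ(w₁, w₁∘Θ) · k_ψ(w_Q, w_Q∘Θ) dμ₀` (Fubini over the two feature parameters). [folklore] -/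
theorem integral_midH_kernels_nonneg (hρ : Continuous ρ) (β : ℝ) {F : Config A d G → ℂ}
    (hFm : Measurable F) {CF : ℝ} (hFb : ∀ U, ‖F U‖ ≤ CF) (hFo : IsMidObservable e Q h F) :
    0 ≤ ∫ U, IsSiteFrame.midH ρ e k σ Q h β F U *
        (SlabKernel.slabKernel (SlabKernel.convPow (SlabKernel.wilsonWt ρ β) m)
          (SlabKernel.oprod (up₂ e k l 0) (2 * m) U)
          (SlabKernel.oprod (up₂ e k l 0) (2 * m) (configMidReflect e k σ U)) : ℂ) *
        (SlabKernel.slabKernel (SlabKernel.convPow (SlabKernel.wilsonWt ρ β) m)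
          (SlabKernel.oprod (lo₂ e k l Q) (2 * m) U)
          (SlabKernel.oprod (lo₂ e k l Q) (2 * m) (configMidReflect e k σ U)) : ℂ)
      ∂(productHaar A d G) := by
  haveI : IsProbabilityMeasure (haarProbability G) := CompactGroup.isProbabilityMeasure_haarMeasure_top
  haveI : IsFiniteMeasure (productHaar A d G) := by unfold productHaar; infer_instance
  have hhm := IsSiteFrame.measurable_midH (e := e) (k := k) (σ := σ) (Q := Q) (h := h) ρ hρ β hFm
  set Ch := (|CF| * Real.exp (|β| * (N * Fintype.card (Plaq A d)))) *
    (|CF| * Real.exp (|β| * (N * Fintype.card (Plaq A d)))) with hCh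
  have hhb : ∀ U, ‖IsSiteFrame.midH ρ e k σ Q h β F U‖ ≤ Ch :=
    fun U => IsSiteFrame.norm_midH_le ρ hρ β hFb U
  have hωc := SlabKernel.continuous_wilsonWt ρ hρ β
  have hωz := SlabKernel.wilsonWt_central ρ β
  set ψ := SlabKernel.convPow (SlabKernel.wilsonWt ρ β) m with hψ
  have hψc : Continuous ψ := SlabKernel.continuous_convPow hωc _
  have hψz : ∀ g g', ψ (g' * g * g'⁻¹) = ψ g := SlabKernel.convPow_central hωz m
  have hψi : ∀ g, ψ g⁻¹ = ψ g := SlabKernel.convPow_inv hωz (SlabKernel.wilsonWt_inv ρ hρ β) m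
  have hw1 : Continuous (SlabKernel.oprod (up₂ (G := G) e k l 0) (2 * m)) :=
    SlabKernel.continuous_oprod (fun t => continuous_apply _) _
  have hwQ : Continuous (SlabKernel.oprod (lo₂ (G := G) e k l Q) (2 * m)) :=
    SlabKernel.continuous_oprod (fun t => continuous_apply _) _
  have hkc : Continuous fun q : G × G => SlabKernel.slabKernel ψ q.1 q.2 :=
    SlabKernel.continuous_uncurry_slabKernel hψc
  obtain ⟨Ck, hCk⟩ := (isCompact_univ (X := G × G)).exists_bound_of_continuousOn hkc.continuousOn
  obtain ⟨Cψ, -, hCψ⟩ := Literature.MathematicalPhysics.QuantumLattice.exists_forall_abs_le_of_continuous hψc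
  have hΘc := continuous_configMidReflect (G := G) e k σ
  -- Step 4: Gram form of the upper kernel
  obtain ⟨Φ₁, hΦ₁⟩ : ∃ Φ : Config A d G → ℂ, Φ = fun U => IsSiteFrame.midH ρ e k σ Q h β F U *
    (SlabKernel.slabKernel ψ (SlabKernel.oprod (up₂ e k l 0) (2 * m) U)
      (SlabKernel.oprod (up₂ e k l 0) (2 * m) (configMidReflect e k σ U)) : ℂ) := ⟨_, rfl⟩
  have hk1c : Continuous fun U : Config A d G =>
      (SlabKernel.slabKernel ψ (SlabKernel.oprod (up₂ e k l 0) (2 * m) U)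
        (SlabKernel.oprod (up₂ e k l 0) (2 * m) (configMidReflect e k σ U)) : ℂ) :=
    Complex.continuous_ofReal.comp (hkc.comp (hw1.prodMk (hw1.comp hΘc)))
  have hΦ₁m : Measurable Φ₁ := by
    rw [hΦ₁]
    exact hhm.mul hk1c.measurable
  have hΦ₁b : ∀ U, ‖Φ₁ U‖ ≤ Ch * Ck := fun U => by
    rw [hΦ₁, norm_mul, Complex.norm_real]
    exact mul_le_mul (hhb U) (hCk (_, _) (Set.mem_univ _)) (norm_nonneg _) ((norm_nonneg _).trans (hhb U))
  have hsplit₁ : ∀ U, IsSiteFrame.midH ρ e k σ Q h β F U *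
      (SlabKernel.slabKernel ψ
        (SlabKernel.oprod (up₂ e k l 0) (2 * m) U)
        (SlabKernel.oprod (up₂ e k l 0) (2 * m) (configMidReflect e k σ U)) : ℂ) *
      (SlabKernel.slabKernel ψ
        (SlabKernel.oprod (lo₂ e k l Q) (2 * m) U)
        (SlabKernel.oprod (lo₂ e k l Q) (2 * m) (configMidReflect e k σ U)) : ℂ) =
      Φ₁ U * (SlabKernel.slabKernel ψ (SlabKernel.oprod (lo₂ e k l Q) (2 * m) U)
        (SlabKernel.oprod (lo₂ e k l Q) (2 * m) (configMidReflect e k σ U)) : ℂ) := fun U => by rw [hΦ₁]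
  simp_rw [hsplit₁]
  rw [SlabKernel.integral_mul_slabKernel_eq (productHaar A d G) (Φ := Φ₁)
    (a := fun U => SlabKernel.oprod (lo₂ e k l Q) (2 * m) U)
    (b := fun U => SlabKernel.oprod (lo₂ e k l Q) (2 * m) (configMidReflect e k σ U))
    hψc hψz hψi hΦ₁m hΦ₁b hwQ.measurable (hwQ.comp hΘc).measurable]
  refine TwoDim.integral_nonneg_of_complex fun u' => ?_
  -- Step 5: Gram form of the lower kernel
  obtain ⟨E, hE⟩ : ∃ E : Config A d G → ℂ, E = fun U =>
    (SlabKernel.featureMap ψ (SlabKernel.oprod (lo₂ e k l Q) (2 * m) U) u' : ℂ) *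
      (SlabKernel.featureMap ψ (SlabKernel.oprod (lo₂ e k l Q) (2 * m) (configMidReflect e k σ U)) u' : ℂ) :=
    ⟨_, rfl⟩
  have hEc : Continuous fun U : Config A d G =>
      (SlabKernel.featureMap ψ (SlabKernel.oprod (lo₂ e k l Q) (2 * m) U) u' : ℂ) *
        (SlabKernel.featureMap ψ (SlabKernel.oprod (lo₂ e k l Q) (2 * m) (configMidReflect e k σ U)) u' : ℂ) :=
    (Complex.continuous_ofReal.comp ((SlabKernel.continuous_featureMap_left hψc u').comp hwQ)).mul
      (Complex.continuous_ofReal.comp ((SlabKernel.continuous_featureMap_left hψc u').comp (hwQ.comp hΘc)))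
  have hEm : Measurable E := by
    rw [hE]
    exact hEc.measurable
  have hCψ0 : 0 ≤ Cψ := (abs_nonneg _).trans (hCψ 1)
  have hEb : ∀ U, ‖E U‖ ≤ Cψ * Cψ := fun U => by
    rw [hE, norm_mul, Complex.norm_real, Complex.norm_real, Real.norm_eq_abs, Real.norm_eq_abs]
    exact mul_le_mul (SlabKernel.abs_featureMap_le hCψ _ _) (SlabKernel.abs_featureMap_le hCψ _ _)
      (abs_nonneg _) hCψ0
  obtain ⟨Φ₂, hΦ₂⟩ : ∃ Φ : Config A d G → ℂ, Φ = fun U => IsSiteFrame.midH ρ e k σ Q h β F U * E U :=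
    ⟨_, rfl⟩
  have hreorder : ∀ U, Φ₁ U *
      ((SlabKernel.featureMap ψ (SlabKernel.oprod (lo₂ e k l Q) (2 * m) U) u' : ℂ) *
        (SlabKernel.featureMap ψ (SlabKernel.oprod (lo₂ e k l Q) (2 * m) (configMidReflect e k σ U)) u' : ℂ)) =
      Φ₂ U * (SlabKernel.slabKernel ψ (SlabKernel.oprod (up₂ e k l 0) (2 * m) U)
        (SlabKernel.oprod (up₂ e k l 0) (2 * m) (configMidReflect e k σ U)) : ℂ) := fun U => by
    simp only [hΦ₁, hΦ₂, hE]; ring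
  simp_rw [hreorder]
  rw [SlabKernel.integral_mul_slabKernel_eq (productHaar A d G) (Φ := Φ₂)
    (a := fun U => SlabKernel.oprod (up₂ e k l 0) (2 * m) U)
    (b := fun U => SlabKernel.oprod (up₂ e k l 0) (2 * m) (configMidReflect e k σ U))
    hψc hψz hψi (by rw [hΦ₂]; exact hhm.mul hEm) (K := Ch * (Cψ * Cψ))
    (fun U => by rw [hΦ₂, norm_mul]; exact mul_le_mul (hhb U) (hEb U) (norm_nonneg _) ((norm_nonneg _).trans (hhb U)))
    hw1.measurable (hw1.comp hΘc).measurable]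
  refine TwoDim.integral_nonneg_of_complex fun u => ?_
  -- Step 6: pointwise in `(u, u')`
  have key := hT.integral_psi_nonneg ρ hρ β hFm hFb hFo u u'
  have heq : ∀ U, Φ₂ U *
      ((SlabKernel.featureMap ψ (SlabKernel.oprod (up₂ e k l 0) (2 * m) U) u : ℂ) *
        (SlabKernel.featureMap ψ (SlabKernel.oprod (up₂ e k l 0) (2 * m) (configMidReflect e k σ U)) u : ℂ)) =
      (IsSiteFrame.midGObs ρ e k Q h β F U *
        (SlabKernel.featureMap ψ (SlabKernel.oprod (up₂ e k l 0) (2 * m) U) u : ℂ) *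
        (SlabKernel.featureMap ψ (SlabKernel.oprod (lo₂ e k l Q) (2 * m) U) u' : ℂ)) *
      conj (IsSiteFrame.midGObs ρ e k Q h β F (configMidReflect e k σ U) *
        (SlabKernel.featureMap ψ (SlabKernel.oprod (up₂ e k l 0) (2 * m) (configMidReflect e k σ U)) u : ℂ) *
        (SlabKernel.featureMap ψ (SlabKernel.oprod (lo₂ e k l Q) (2 * m) (configMidReflect e k σ U)) u' : ℂ)) :=
    fun U => by
      simp only [hΦ₂, hE, IsSiteFrame.midH, map_mul, Complex.conj_ofReal]; ring
  simp_rw [heq]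
  exact key

/-- **Link reflection positivity in two dimensions at EVERY real `β`.** On a periodic lattice with
a two-dimensional site frame `IsTwoDimFrame e k l σ Q h m` (a site frame along `k`, one transverse
direction `l` of even period `2m`, the site group generated by `e_k, e_l`; e.g. either axis of the
even torus `(ℤ/2Q)^2`), for a compact second countable group `G`, a continuous matrix representation
`ρ` and EVERY real `β`: for every bounded measurable observable `F` of the closed half
`{1 ≤ h ≤ Q}`, `0 ≤ ∫ conj F(ΘU) F(U) dμ_β(U)`, `Θ` the Osterwalder–Seiler reflection in the
hyperplane `h = ½`. (In `d ≥ 3` this fails at every `β < 0` for `SU(3)`: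
`IsSiteFrame.not_linkRP_of_neg`.) Small new positive result; 2D Yang–Mills gluing. -/
theorem linkRP_integral_conj_mul_nonneg (hρ : Continuous ρ) (β : ℝ) (F : Config A d G → ℂ)
    (hFm : Measurable F) (hFb : ∃ C : ℝ, ∀ U, ‖F U‖ ≤ C) (hFo : IsMidObservable e Q h F) :
    0 ≤ ∫ U, conj (F (configMidReflect e k σ U)) * F U ∂(gibbs ρ e β) := by
  classical
  obtain ⟨CF, hFb⟩ := hFb
  have hZ := normaliser_pos (A := A) (G := G) ρ hρ e β
  rw [integral_gibbs]
  simp_rw [Complex.real_smul, Complex.ofReal_div, div_eq_mul_inv, mul_comm (Complex.ofReal _) ((_ : ℂ)⁻¹),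
    mul_assoc]
  rw [integral_const_mul]
  refine mul_nonneg (by rw [← Complex.ofReal_inv]; exact Complex.zero_le_real.2 (inv_nonneg.2 hZ.le)) ?_
  simp_rw [hT.boltzmann_split ρ hρ β F]
  rw [integral_const_mul]
  refine mul_nonneg (Complex.zero_le_real.2 (Real.exp_pos _).le) ?_
  rw [hT.integral_midH_annuli ρ hρ β hFm hFb hFo]
  exact hT.integral_midH_kernels_nonneg ρ hρ β hFm hFb hFo

end IsTwoDimFrame

end TiltedRP

end Summit.QuantumFields.GaugeBoot

end
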